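import Summits.BirchSwinnertonDyer.BirchSwinnertonDyer.Theorems.CyclotomicUntwistDescendedFrobeniusPin
import Summits.BirchSwinnertonDyer.BirchSwinnertonDyer.Theorems.CyclotomicUntwistSecondKindLogClassesLift
import Summits.BirchSwinnertonDyer.BirchSwinnertonDyer.Theorems.CyclotomicUntwistDescendedFrobeniusRational
import HarnessLib

/-!
# D5 CANDIDATE (crux workfile, NOT a tree definition): the descended Frobenius matrix PINNED RELATIVE TO THE TWO
# GOOD-MODEL CLASSES — `IsPinnedFrobeniusMatrix b ω̂ η̂ M` — with its API (u) uniqueness, (t) `tr = a_w, det = 3`,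
# (g) `γ·det P = a² + a_w ab + 3b²` PROVED from the landed files (route `CyclotomicUntwist`, crux K1 21580 / K2 21581)

Seat `bsd-line-cycu-p2` g6, lane «D5 TYPING»; companion of `Cruxes/PSRankOneLowerHalfAtThree/D5-TYPING-v1.md` §3 (level (A)).
For the pen (`defn-IsDescendedFrobeniusMatrix`, ruling 09:22:02Z (K1′)) and the definition typer. Elaborates rc 0 against
the tree (imports only ACCEPTED files p624873 / p625987 / p626158). Nothing here is a Literature fact; BSD is not proved
by any of this; K1/K2 stay WHOLE.

WHAT IS LEFT TO THE TYPER after this file: ONLY the two series `ω̂(W), η̂(W) ∈ L⟦X⟧` — the representatives of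
`[ω_W] = u⁻¹[log_{W′}]` and `[η_W] = u·[f_{η,W′}] + r·u⁻¹[log_{W′}]` (`f_η = ∫(x′ω′ − d(y′/x′))`) on the good model `W′`
of the leaf recipe (`CyclotomicUntwistGNineLeaves/LeafIV/SpecialFibre`), read in an ultrametric normed field
`L ⊇ ℚ₃` containing `ζ₉` — and `b(W) := −a_w(W)/3`. Then
`W.IsDescendedFrobeniusMatrix M :↔ IsPinnedFrobeniusMatrix (b W) (ω̂ W) (η̂ W) M` has (u),(t) by the theorems below,
(g) by `isPinned_lower_left_ne_zero_of_rational` once the coordinates are known `ℚ₃`-rational (descent), and (e) is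
the one named fact (Berthelot–Ogus 2.4 + Katz 5.5: SOME `(a,b,c,d)` with `ad − bc ≠ 0` exists and the pinned `M` is
Fontaine's `φ` on `D_cris,L(V₃E) ⊗ L = H¹_dR(E/ℚ₃) ⊗ L` in the basis `(ω, xω)`).
-/

set_option autoImplicit false
set_option linter.dupNamespace false

noncomputable section

open PowerSeries Literature.RingTheory.FormalGroups
  Summit.BirchSwinnertonDyer.BirchSwinnertonDyer.Theorems

namespace Summit.BirchSwinnertonDyer.BirchSwinnertonDyer.Cruxes.PSRankOneLowerHalfAtThree.D5PinCandidate

variable {K : Type*} [NormedField K] [NormedAlgebra ℚ_[3] K] [IsUltrametricDist K]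

/-- Shorthand-free: the logarithm of the canonical lift `y² = x³ − x + b` over `ℚ₃`, read in `K`. (A `def` only in
this workfile; in the tree one writes the term out.) -/
def logLift (b : ℤ_[3]) (K : Type*) [NormedField K] [NormedAlgebra ℚ_[3] K] : K⟦X⟧ :=
  ((⟨0, 0, 0, -1, (b : ℚ_[3])⟩ : WeierstrassCurve ℚ_[3]).formalLog).map (algebraMap ℚ_[3] K)

/-- The untwisted trace of the lift's special fibre, `a = −3·valMinAbs b̄ ∈ {0, ±3}` (on a K1/K2 row `= a_w(W)` with
`b = −a_w/3`). -/
def traceLift (b : ℤ_[3]) : ℤ := -3 * ZMod.valMinAbs (PadicInt.toZMod b)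

/-- **D5 CANDIDATE.** `IsPinnedFrobeniusMatrix b ω̂ η̂ M`: there are coordinates `(a, b′, c, d) ∈ K⁴` with
`a d − b′ c ≠ 0` such that, modulo series with BOUNDED coefficients,
`ω̂ ≡ a·log₀(X⁹) + b′·log₀(X²⁷)` and `η̂ ≡ c·log₀(X⁹) + d·log₀(X²⁷)` (`log₀ = logLift b`, the Berthelot–Ogus transfer
`Ψ = expand 9` of Katz's classes `[log₀], [log₀(X³)]`), and `M` is intertwined with the companion matrix of
`X² − aX + 3` (`a = traceLift b`): `P·M = C·P`, `P = !![a, c; b′, d]`, `C = !![0, −3; 1, a]` — route convention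
`φω̂ = M₀₀ω̂ + M₁₀η̂`, `φη̂ = M₀₁ω̂ + M₁₁η̂`. -/
def IsPinnedFrobeniusMatrix (b : ℤ_[3]) (ωh ηh : K⟦X⟧) (M : Matrix (Fin 2) (Fin 2) K) : Prop :=
  ∃ a b' c d : K, a * d - b' * c ≠ 0 ∧
    (∃ C : ℝ, ∀ n, ‖coeff n (ωh - expand 9 (by norm_num) (PowerSeries.C a * logLift b K +
      PowerSeries.C b' * expand 3 (prime_ne_zero 3) (logLift b K)))‖ ≤ C) ∧
    (∃ C : ℝ, ∀ n, ‖coeff n (ηh - expand 9 (by norm_num) (PowerSeries.C c * logLift b K +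
      PowerSeries.C d * expand 3 (prime_ne_zero 3) (logLift b K)))‖ ≤ C) ∧
    !![a, c; b', d] * M = !![0, -3; 1, ((traceLift b : ℤ) : K)] * !![a, c; b', d]

omit [IsUltrametricDist K] in
/-- The source-side hypotheses of the general theorems hold for `log₀`: `[X¹] = 1`, Honda type `3 − aT + T²`,
`‖a‖ ≤ 3⁻¹`. -/
theorem source_hyps (b : ℤ_[3]) :
    coeff 1 ((⟨0, 0, 0, -1, (b : ℚ_[3])⟩ : WeierstrassCurve ℚ_[3]).formalLog) = 1 ∧
    (∀ n, ‖coeff n (hondaShift 3 ((traceLift b : ℤ) : ℚ_[3])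
        (⟨0, 0, 0, -1, (b : ℚ_[3])⟩ : WeierstrassCurve ℚ_[3]).formalLog)‖ ≤ 1) ∧
    ‖((traceLift b : ℤ) : ℚ_[3])‖ ≤ ((3 : ℕ) : ℝ)⁻¹ := by
  refine ⟨WeierstrassCurve.coeff_one_formalLog _, SecondKindLogClasses.hondaShift_log_lift b, ?_⟩
  have := SecondKindLogClasses.norm_tr_lift_le b
  rwa [SecondKindLogClasses.tr_lift] at this

/-- **(u) UNIQUENESS**: `IsPinnedFrobeniusMatrix b ω̂ η̂ M → IsPinnedFrobeniusMatrix b ω̂ η̂ M′ → M = M′`. -/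
theorem isPinned_unique {b : ℤ_[3]} {ωh ηh : K⟦X⟧} {M M' : Matrix (Fin 2) (Fin 2) K}
    (h : IsPinnedFrobeniusMatrix b ωh ηh M) (h' : IsPinnedFrobeniusMatrix b ωh ηh M') : M = M' := by
  obtain ⟨a, b', c, d, hP, hω, hη, hM⟩ := h
  obtain ⟨a₁, b₁, c₁, d₁, -, hω₁, hη₁, hM₁⟩ := h'
  obtain ⟨h1, hT, ha⟩ := source_hyps b
  have hPP : (!![a, c; b', d] : Matrix (Fin 2) (Fin 2) K) = !![a₁, c₁; b₁, d₁] :=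
    DescendedFrobeniusPin.pin_matrix_coords_unique ha h1 hT (by norm_num) ωh ηh hω hη hω₁ hη₁
  rw [← hPP] at hM₁
  have hdet : (!![a, c; b', d] : Matrix (Fin 2) (Fin 2) K).det ≠ 0 := by
    rw [Matrix.det_fin_two_of]; intro h0; exact hP (by linear_combination h0)
  exact DescendedFrobeniusPin.pin_matrix_unique hdet hM hM₁

omit [IsUltrametricDist K] in
/-- **(t)**: `tr M = a` (`= a_w`) and `det M = 3`. -/
theorem isPinned_trace_det {b : ℤ_[3]} {ωh ηh : K⟦X⟧} {M : Matrix (Fin 2) (Fin 2) K}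
    (h : IsPinnedFrobeniusMatrix b ωh ηh M) : M.trace = ((traceLift b : ℤ) : K) ∧ M.det = 3 := by
  obtain ⟨a, b', c, d, hP, -, -, hM⟩ := h
  obtain ⟨htr, hdet, -, -⟩ := DescendedFrobeniusPin.pin_api hP hM
  exact ⟨htr, hdet⟩

/-- **(g), criterion**: for any witness coordinates, `γ·(ad − b′c) = a² + a_w·a·b′ + 3·b′²`; hence `γ = M₁₀ ≠ 0` as soon
as `X² − a_w X + 3` has no root in the coordinate field. Over `K = ℚ₃` this is automatic: -/
theorem isPinned_lower_left_ne_zero_of_rational {b : ℤ_[3]} {ωh ηh : ℚ_[3]⟦X⟧} {M : Matrix (Fin 2) (Fin 2) ℚ_[3]}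
    (h : IsPinnedFrobeniusMatrix b ωh ηh M) : M 1 0 ≠ 0 := by
  obtain ⟨a, b', c, d, hP, -, -, hM⟩ := h
  obtain ⟨-, -, -, hg⟩ := DescendedFrobeniusPin.pin_api hP hM
  refine hg fun x ↦ ?_
  have h3 : ((3 : ℕ) : ℤ) ∣ traceLift b := ⟨-ZMod.valMinAbs (PadicInt.toZMod b), by unfold traceLift; push_cast; ring⟩
  have := DescendedFrobeniusCharpoly.padic_no_root_of_dvd (p := 3) h3 x
  simpa using this

end Summit.BirchSwinnertonDyer.BirchSwinnertonDyer.Cruxes.PSRankOneLowerHalfAtThree.D5PinCandidate
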